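import Summits.CriticalPhenomena.CardyFormulaZ2.Theses.CardySelfRefinement
import Summits.CriticalPhenomena.CardyFormulaZ2.Theorems.CardySelfRefinementInterfaceToCardyBridge
import Summits.CriticalPhenomena.CardyFormulaZ2.Theorems.CardyComplexConeSLESixFamiliesGiveCardy
import HarnessLib

/-!
# Sketch — crux-ideate stmt-CriticalPhenomena-10278 (`InterfaceToCardy`), ideator 2, round 1

Idea `compose-closed-sibling`: the crux is the SAME proposition as the sibling crux
`CardyComplexCone.SLESixFamiliesGiveCardy` (stmt-CriticalPhenomena-9654), which is CLOSED in tree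
(`CollarTouchSandwich.SLESixFamiliesGiveCardy_of`, Theorems/CardyComplexConeSLESixFamiliesGiveCardy.lean),
and the bridge `interfaceToCardy_of_slesixFamiliesGiveCardy` (Theorems/CardySelfRefinementInterfaceToCardyBridge.lean)
is landed.  First lemma = the whole proof.
-/

namespace Summit.CriticalPhenomena.CardyFormulaZ2.Cruxes.InterfaceToCardy.ComposeClosedSibling

/-- First lemma of idea `compose-closed-sibling` (it is the entire line). -/
theorem interfaceToCardy_holds :
    Summit.CriticalPhenomena.CardyFormulaZ2.Theses.CardySelfRefinement.InterfaceToCardy :=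
  Summit.CriticalPhenomena.CardyFormulaZ2.Theorems.InterfaceToCardyBridge.interfaceToCardy_of_slesixFamiliesGiveCardy
    Summit.CriticalPhenomena.CardyFormulaZ2.Cruxes.SLESixFamiliesGiveCardy.CollarTouchSandwich.SLESixFamiliesGiveCardy_of

/-- The shared twin decl of route `CardyRotToConf` (stmt-8603 form) closes by the same term. -/
theorem cardyRotToConfSLE6ToCardy_holds :
    (Summit.CriticalPhenomena.CardyFormulaZ2.SLE6LimitZ2AllDiscretisations → _root_.CardyFormulaZ2) :=
  Summit.CriticalPhenomena.CardyFormulaZ2.Theorems.InterfaceToCardyBridge.interfaceToCardy_iff_of_conjecture.1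
    interfaceToCardy_holds

end Summit.CriticalPhenomena.CardyFormulaZ2.Cruxes.InterfaceToCardy.ComposeClosedSibling
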